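import Summits.ABC.IUTFork.Joshi.ATS4Eq6111ComponentSumsGenuine
import Literature.NumberTheory.EllipticCurves.MultiplicativeTrivialTorsionDvdRamificationProofs
import Literature.IUT.LogVolume.Corollary22GaloisImage
import Literature.IUT.LogVolume.ThetaTowerRamification
import HarnessLib

/-!
# [J-IV] (arXiv:2403.10430v2) Lemma 6.7.1 (4) ⟹ (2) «a prime under `Supp(q_L)` ramifies in `L′ = L(C[ℓ])`» on the genuine
# `ℓ`-DIVISION tower — DERIVED modulo the located rider `ℓ ∤ ord_v(q_v)`; rows Y-21c / Y-21e under the §6.6 DEFINITION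

Proof-only companion (0 defs) of the abc-iut cell, R-J rows **Y-21c** (`LocusVolumeDatum.Eq6111`) / **Y-21e**
(`LocusVolumeDatum.ComponentSums`), rung LADDER-ABC:A2.RESCUE.J, seat abc-iut-E-t35 (gen 7; authors-first sequel of its own
p456387 `Joshi/ATS4Eq6111ComponentSumsGenuine.lean`, whose `componentSums_of_genuine_defn` keeps Joshi's Lemma 6.7.1 (4) ⟹ (2)
BY NAME as the hypothesis `h412`). SOURCE: K. Joshi, *Construction of Arithmetic Teichmüller Spaces IV*, arXiv:2403.10430v2
(unrefereed; bib `Joshi2024ATS4`), Lemma 6.7.1 p.61 l.20–30 («the following conditions are equivalent (1) `v_ℚ ∈ V^dst_ℚ` (2) `v_ℚ`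
ramifies in `L′` (3) `v_ℚ` divides `30·ℓ` or `v_ℚ` is in the image of `Supp(q_{L_tpd} + d_{L_tpd})` (4) `v_ℚ` divides `30·ℓ` or
`v_ℚ` is in the image of `Supp(q_L + d_L)`»), §6.6 p.60 l.56–62 («`v ∈ V^dst_M` iff `v` extends to a prime of `L′` which is
ramified over `ℚ`»), [J-III] (arXiv:2401.13508v4) §3.3 (13) p.28 l.11 («Let `L′` be the fixed field of the kernel of
`ρ_{C/L;ℓ}`»), [J-IV] Lemma 5.8.7 (2) p.56 l.38–41 («`ℓ ∤ a_v` for any `a_v ≠ 0`») and Thm. 5.7.1 p.53 l.31–46. Page/line = the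
cell's render `HOME/lit/renders/Joshi-arxiv-2403.10430/`. FRAMING (binding): classical arithmetic of the Legendre curve composed
with the tree's PROVED theorems; NO side is taken on [IUTchIII] Cor. 3.12 / [IUTchIV] Thm. 1.10, on Joshi's claims or on
Mochizuki's report on them; NOT a test verdict; NO abc claim. Typed ≠ proved ≠ endorsed.

WHAT IS PROVED. On the genuine `ℓ`-division tower of a `λ`-line point — `F_tpd = ℚ(λ) ⊆ F` a theta field (`Cor22.IsThetaField`)
`⊆ K` a number field over which the `ℓ`-torsion of the Legendre curve `E_K : y² = x(x−1)(x−λ)` is pointwise `Γ_K`-invariant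
(`K ⊇ F(E_F[ℓ])`: Joshi's (13) `L′ = L(C[ℓ])`, Mochizuki's [IUTchI] Def. 3.1 (c) `K = F(E_F[l])`, in the currency of the tree's
`Cor22.IsThetaField.torsion_rational` / `MultiplicativeTrivialTorsionDvdOrdProofs`), `ℓ ≥ 7` prime, UNDER THE RIDER
`Cor22.CondP2 P ℓ` («`ℓ ∤ ord_v(j(λ))` at every pole», i.e. `ℓ` prime to the orders of the `q`-parameters):
* `GenuineVdst.ell_dvd_relRamIdx_of_finBelow_mem_badPlaces` — every place `u ∤ ℓ` of `K` over a bad place of `λ` has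
  **`ℓ ∣ e_{u|w}`** (`w = u ∩ 𝓞_F`; E-t26's `relRamIdx`), hence `e_{u|w} ≥ 7`, `ℓ ∣ e(u|p_u)`, `e(u|p_u) ≥ 2` and
  `p_u ∣ disc(K)`: **Lemma 6.7.1 (4) ⟹ (2)/(1) for the primes under `Supp(q_L)`** (`residueChar_mem_primeFactors_discr_of_…`;
  the `d_L`-part of (4) ⟹ (2) is tautological, the `30ℓ`-part is «`L′ ⊇ ℚ(ζ_{60ℓ})`», not treated here);
* `GenuineVdst.h412_ofNFPointOver` — the hypothesis `h412` of p456387's `componentSums_of_genuine_defn` DISCHARGED for Joshi's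
  own Tate-divisor data `𝔮_F = ofNFPointOver λ S F` with `ℓ ∈ S` (his `S = {2, ℓ}`, E-t30 p440894), and the image form
  `p(Supp 𝔮_F) ⊆ primeFactors(disc K)`, `p(Supp 𝔮_{F_tpd}) ⊆ primeFactors(disc K)` (the `q`-clause of (3)/(4) ⟹ (1));
* `LocusVolumeDatum.componentSums_divisionTower_defn`, `LocusVolumeDatum.eq6111_divisionTower_defn` — **rows Y-21e and Y-21c
  with `V^dst_ℚ` read by the §6.6 DEFINITION (`primeFactors(disc K)`) DERIVED on the division tower**, modulo the rider.
* (v2, §5) `GenuineVdst.primeFactors_discr_sdiff_eq_reading3_sdiff` — on `K = F(E_F[ℓ])` (both inclusions) **Lemma 6.7.1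
  (1) ⟺ (3) holds AWAY FROM the primes of `30ℓ`** (the §6.6 definition and reading (3) have the same primes off `30ℓ`), modulo
  the rider; `disc(F_tpd) ∣ disc(K)` (Mathlib `NumberField.discr_dvd_discr`) supplies the `d`-clauses.

THE RIDER, LOCATED (not adjudicated): `CondP2 P ℓ` = [IUTchIV] Cor. 2.2 (P2) = [IUTchI] Def. 3.1 (c) «`l` prime to the orders
of the `q`-parameters» = Joshi's OWN Lemma 5.8.7 (2) «`ℓ ∤ a_v` for any `a_v ≠ 0`» for the prime `ℓ` PRODUCED by his
existence theorem 5.7.1 — but it is NOT among the standing hypotheses «[J-III] §3.1, §3.3, [J-IV] §4.1.1, §4.1.2» under which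
Thm. 6.1.1 and Lemma 6.7.1 are stated. Without it (4) ⟹ (2) fails ON PAPER (not in kernel here): for `C/ℚ` semistable with
`30ℓ ∣ ord_p(Δ_C)` at an odd prime `p ∤ 15ℓ`, `p` lies under `Supp(q_L)` but is unramified in `L′ = ℚ(√−1, C[30ℓ])`
(Tate: `ℚ_p^{nr}(C[N]) = ℚ_p^{nr}(ζ_N, q^{1/N})`). Inputs: the classical `Literature.NumberTheory.EllipticCurves.
MultiplicativeTrivialTorsionDvdRamificationProofs` (this seat, p461504: `K ⊇ F(E[p])`, `v` multiplicative, `p ∤ ord_v(Δ_min)` ⟹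
`p ∣ e(w|v)`), `Cor22.thetaCurve_hasMultiplicativeReductionAt_of_mem_badPlaces` / `not_dvd_localHeight_thetaEllPoint`
(multiplicative reduction of `E_F` above the poles of `j(λ)`, `ℓ ∤ h_w` from (P2) for `ℓ ≥ 7`), Dedekind
(`GenuineVdst.residueChar_mem_primeFactors_discr`). Theorems only; standard axioms; no `sorry`, instance, notation, `def` or new
`Prop`. [claim: Joshi2024ATS4, status: disputed].
-/

noncomputable section

open Finset NumberField IsDedekindDomain
open Literature.IUT.LogVolume Literature.IUT.LogVolume.Cor22
open Literature.NumberTheory.DiophantineGeometry.GenEll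

namespace Summit.ABC.IUTFork.Joshi.ATS4

/-! ## 1. The Legendre curve above the bad places of `λ`: multiplicative, `ℓ ∤ ord(Δ_min)` under (P2) -/

namespace GenuineVdst

variable {P : NFPoint} {F : Type} [Field F] [NumberField F] [Algebra P.F F]
variable {K : Type} [Field K] [NumberField K] [Algebra F K] [Algebra P.F K] [IsScalarTower P.F F K]

/-- `E_F ⊗_F K = E_K`: the base change of the Legendre curve of `λ` over `F` to `K ⊇ F` is the Legendre curve of `λ` over `K`
(same literal `⟨0, −(1+λ), 0, λ, 0⟩`). [folklore] -/
theorem thetaCurve_baseChange : (thetaCurve P F).baseChange K = thetaCurve P K := by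
  simp only [thetaCurve, WeierstrassCurve.baseChange, WeierstrassCurve.map, map_zero, map_neg, map_add, map_one,
    ← IsScalarTower.algebraMap_apply P.F F K]

/-- **(P2) ⟹ `ℓ ∤ ord_w(Δ_min(E_F))`** at every multiplicative place `w` of the theta field, for `ℓ ≥ 7`
(`not_dvd_localHeight_thetaEllPoint`: `h_w = e(w|v)·h_v(λ)` with `ℓ ∤ h_v(λ)` by (P2) and `e(w|v) ∣ [F:F_tpd] ∣ 2¹⁰·3²·5`).
This is where the rider enters. [cite: Mochizuki2012, IUTchIV Cor 2.2 proof p.45 (P2)] -/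
theorem not_dvd_ordMinimalDiscriminant_of_condP2 (hU : P.InU) (hF : IsThetaField P F) {ℓ : ℕ} (hℓ : ℓ.Prime)
    (h7 : 7 ≤ ℓ) (hP2 : CondP2 P ℓ) (w : HeightOneSpectrum (𝓞 F)) (hmult : (thetaCurve P F).HasMultiplicativeReductionAt w) :
    ¬ ℓ ∣ (thetaCurve P F).ordMinimalDiscriminant w := fun h =>
  not_dvd_localHeight_thetaEllPoint F hU hF hℓ h7 hP2 w hmult
    (((thetaEllPoint P hU F).natCast_dvd_localHeight_iff hmult ℓ).mpr h)

omit [NumberField F] [NumberField K] [Algebra P.F F] in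
/-- A natural number not in the place `u ∩ 𝓞_F` of `F` is not in the place `u` of `K`. [folklore] -/
theorem natCast_not_mem_of_finBelow {n : ℕ} (u : HeightOneSpectrum (𝓞 K)) (h : ((n : ℕ) : 𝓞 F) ∉ (finBelow F K u).asIdeal) :
    ((n : ℕ) : 𝓞 K) ∉ u.asIdeal := fun hu => h (by
  change ((n : ℕ) : 𝓞 F) ∈ Ideal.comap (algebraMap (𝓞 F) (𝓞 K)) u.asIdeal
  rw [Ideal.mem_comap, map_natCast]
  exact hu)

/-! ## 2. Lemma 6.7.1 (4) ⟹ (2) for the primes under `Supp(q_L)`, on the `ℓ`-division tower, modulo (P2) -/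

/-- **`ℓ ∣ e_{u|w}` at every place `u ∤ ℓ` of `K ⊇ F(E_F[ℓ])` over a bad place of `λ`** (`w = u ∩ 𝓞_F`; E-t26's `relRamIdx`):
for `λ ∈ U_X`, `F` a theta field, `K ⊇ F` a number field with `Γ_K` fixing `E_K[ℓ]` pointwise ([J-III] §3.3 (13) `L′ = L(C[ℓ])`),
`ℓ ≥ 7` prime with (P2) (the RIDER `CondP2`: `ℓ ∤ ord_v(q_v)`, Joshi's Lemma 5.8.7 (2)). Classical (Silverman *ATAEC* V.6.1 /
Ex. 5.13 (b)) via the tree's `dvd_ramificationIdx_of_forall_smul_geomTorsion_baseChange_eq`. PROVED.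
[claim: Joshi2024ATS4, status: disputed] [cite: SilvermanATAEC1994, V.6 Prop. 6.1 (p. 410)] -/
theorem ell_dvd_relRamIdx_of_finBelow_mem_badPlaces (hU : P.InU) (hF : IsThetaField P F) {ℓ : ℕ} (hℓ : ℓ.Prime)
    (h7 : 7 ≤ ℓ) (hP2 : CondP2 P ℓ)
    (hKℓ : ∀ (σ : Field.absoluteGaloisGroup K) (Q : WeierstrassCurve.geomTorsion (thetaCurve P K) (ℓ : ℤ)), σ • Q = Q)
    (u : HeightOneSpectrum (𝓞 K)) (hu : finBelow P.F K u ∈ badPlaces P) (hℓu : ((ℓ : ℕ) : 𝓞 K) ∉ u.asIdeal) :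
    ℓ ∣ relRamIdx F K u := by
  haveI := thetaCurve_isElliptic hU F
  have hw : finBelow P.F F (finBelow F K u) ∈ badPlaces P := by rwa [finBelow_finBelow]
  have hmult := thetaCurve_hasMultiplicativeReductionAt_of_mem_badPlaces F hU hF (finBelow F K u) hw
  have hfix : ∀ (σ : Field.absoluteGaloisGroup K)
      (Q : WeierstrassCurve.geomTorsion ((thetaCurve P F).baseChange K) (ℓ : ℤ)), σ • Q = Q := by
    rw [thetaCurve_baseChange]
    exact hKℓ
  exact (thetaCurve P F).dvd_ramificationIdx_of_forall_smul_geomTorsion_baseChange_eq (w := u) hmult hℓ (by omega)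
    hℓu hfix (not_dvd_ordMinimalDiscriminant_of_condP2 hU hF hℓ h7 hP2 _ hmult)

/-- Hence **`e_{u|w} ≥ ℓ ≥ 7`**: `u` is (highly) RAMIFIED over `F`. [claim: Joshi2024ATS4, status: disputed] -/
theorem le_relRamIdx_of_finBelow_mem_badPlaces (hU : P.InU) (hF : IsThetaField P F) {ℓ : ℕ} (hℓ : ℓ.Prime)
    (h7 : 7 ≤ ℓ) (hP2 : CondP2 P ℓ)
    (hKℓ : ∀ (σ : Field.absoluteGaloisGroup K) (Q : WeierstrassCurve.geomTorsion (thetaCurve P K) (ℓ : ℤ)), σ • Q = Q)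
    (u : HeightOneSpectrum (𝓞 K)) (hu : finBelow P.F K u ∈ badPlaces P) (hℓu : ((ℓ : ℕ) : 𝓞 K) ∉ u.asIdeal) :
    ℓ ≤ relRamIdx F K u :=
  Nat.le_of_dvd (Nat.pos_of_ne_zero
      (Ideal.IsDedekindDomain.ramificationIdx'_ne_zero_of_liesOver u.asIdeal (finBelow F K u).ne_bot))
    (ell_dvd_relRamIdx_of_finBelow_mem_badPlaces hU hF hℓ h7 hP2 hKℓ u hu hℓu)

/-- **`ℓ ∣ e(u|p_u)`**: the ABSOLUTE ramification index of such a place `u` is divisible by `ℓ` (`e(u|p_u) = e(w|p_u)·e_{u|w}`).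
[claim: Joshi2024ATS4, status: disputed] -/
theorem ell_dvd_absRamificationIdx_of_finBelow_mem_badPlaces (hU : P.InU) (hF : IsThetaField P F) {ℓ : ℕ} (hℓ : ℓ.Prime)
    (h7 : 7 ≤ ℓ) (hP2 : CondP2 P ℓ)
    (hKℓ : ∀ (σ : Field.absoluteGaloisGroup K) (Q : WeierstrassCurve.geomTorsion (thetaCurve P K) (ℓ : ℤ)), σ • Q = Q)
    (u : HeightOneSpectrum (𝓞 K)) (hu : finBelow P.F K u ∈ badPlaces P) (hℓu : ((ℓ : ℕ) : 𝓞 K) ∉ u.asIdeal) :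
    ℓ ∣ u.asIdeal.ramificationIdx ℤ :=
  (ell_dvd_relRamIdx_of_finBelow_mem_badPlaces hU hF hℓ h7 hP2 hKℓ u hu hℓu).trans
    (WeierstrassCurve.ramificationIdx'_dvd_absRamificationIdx (finBelow F K u) u)

/-- **Lemma 6.7.1 (4) ⟹ (2), `q_L`-clause, in the cell's shape `2 ≤ e(u|p_u)`**: every place `u ∤ ℓ` of `K ⊇ F(E_F[ℓ])` over a bad
place of `λ` is RAMIFIED OVER `ℚ` — on the `ℓ`-division tower, modulo the rider (P2). PROVED. [claim: Joshi2024ATS4, status: disputed] -/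
theorem two_le_absRamificationIdx_of_finBelow_mem_badPlaces (hU : P.InU) (hF : IsThetaField P F) {ℓ : ℕ} (hℓ : ℓ.Prime)
    (h7 : 7 ≤ ℓ) (hP2 : CondP2 P ℓ)
    (hKℓ : ∀ (σ : Field.absoluteGaloisGroup K) (Q : WeierstrassCurve.geomTorsion (thetaCurve P K) (ℓ : ℤ)), σ • Q = Q)
    (u : HeightOneSpectrum (𝓞 K)) (hu : finBelow P.F K u ∈ badPlaces P) (hℓu : ((ℓ : ℕ) : 𝓞 K) ∉ u.asIdeal) :
    2 ≤ u.asIdeal.ramificationIdx ℤ := by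
  have hpos : 0 < u.asIdeal.ramificationIdx ℤ := Ideal.ramificationIdx_pos _ _
  have h := Nat.le_of_dvd hpos (ell_dvd_absRamificationIdx_of_finBelow_mem_badPlaces hU hF hℓ h7 hP2 hKℓ u hu hℓu)
  omega

/-- **Lemma 6.7.1 (4) ⟹ (1), `q_L`-clause, in `Finset` form**: the residue characteristic of such a place `u` divides `disc(K)`,
i.e. lies in `primeFactors(disc K)` = the §6.6 reading of `V^dst_ℚ` (Dedekind, `residueChar_mem_primeFactors_discr`). PROVED.
[claim: Joshi2024ATS4, status: disputed] -/
theorem residueChar_mem_primeFactors_discr_of_finBelow_mem_badPlaces (hU : P.InU) (hF : IsThetaField P F) {ℓ : ℕ}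
    (hℓ : ℓ.Prime) (h7 : 7 ≤ ℓ) (hP2 : CondP2 P ℓ)
    (hKℓ : ∀ (σ : Field.absoluteGaloisGroup K) (Q : WeierstrassCurve.geomTorsion (thetaCurve P K) (ℓ : ℤ)), σ • Q = Q)
    (u : HeightOneSpectrum (𝓞 K)) (hu : finBelow P.F K u ∈ badPlaces P) (hℓu : ((ℓ : ℕ) : 𝓞 K) ∉ u.asIdeal) :
    residueChar K u ∈ (discr K).natAbs.primeFactors :=
  residueChar_mem_primeFactors_discr u (two_le_absRamificationIdx_of_finBelow_mem_badPlaces hU hF hℓ h7 hP2 hKℓ u hu hℓu)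

/-! ## 3. The hypothesis `h412` of `componentSums_of_genuine_defn` DISCHARGED for Joshi's data `ofNFPointOver λ S F`, `ℓ ∈ S` -/

/-- A place `w ∈ Supp(𝔮_F)` of Joshi's data `𝔮_F = ofNFPointOver λ S F` lies over a bad place of `λ` avoiding the primes of `S`
(E-t30's `mem_ofNFPointOver_V_iff` + T-26's `mem_ofNFPoint_V`). [folklore] -/
theorem finBelow_mem_badPlaces_of_mem_ofNFPointOver {S : Finset ℕ} {w : HeightOneSpectrum (𝓞 F)}
    (hw : w ∈ (TateDivisorDatum.ofNFPointOver P S F).V) :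
    finBelow P.F F w ∈ badPlaces P ∧ ∀ p ∈ S, ((p : ℕ) : 𝓞 P.F) ∉ (finBelow P.F F w).asIdeal :=
  (TateDivisorDatum.mem_ofNFPoint_V P S _).1 ((TateDivisorDatum.mem_ofNFPointOver_V_iff P S F w).1 hw)

/-- **`h412` DISCHARGED (the `L = K`-level form)**: every place `u ∈ Supp(𝔮_K)` of Joshi's data over `K ⊇ F(E_F[ℓ])` itself, with
`ℓ ∈ S`, has `2 ≤ e(u|p_u)`. [claim: Joshi2024ATS4, status: disputed] -/
theorem two_le_absRamificationIdx_of_mem_ofNFPointOver (hU : P.InU) (hF : IsThetaField P F) {ℓ : ℕ} (hℓ : ℓ.Prime)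
    (h7 : 7 ≤ ℓ) (hP2 : CondP2 P ℓ)
    (hKℓ : ∀ (σ : Field.absoluteGaloisGroup K) (Q : WeierstrassCurve.geomTorsion (thetaCurve P K) (ℓ : ℤ)), σ • Q = Q)
    {S : Finset ℕ} (hS : ℓ ∈ S) (u : HeightOneSpectrum (𝓞 K)) (hu : u ∈ (TateDivisorDatum.ofNFPointOver P S K).V) :
    2 ≤ u.asIdeal.ramificationIdx ℤ := by
  obtain ⟨hbad, hSav⟩ := (TateDivisorDatum.mem_ofNFPoint_V P S _).1
    ((TateDivisorDatum.mem_ofNFPointOver_V_iff P S K u).1 hu)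
  refine two_le_absRamificationIdx_of_finBelow_mem_badPlaces hU hF hℓ h7 hP2 hKℓ u hbad ?_
  have h1 : ((ℓ : ℕ) : 𝓞 F) ∉ (finBelow F K u).asIdeal := by
    refine natCast_not_mem_of_finBelow (F := P.F) (finBelow F K u) ?_
    rw [finBelow_finBelow]
    exact hSav ℓ hS
  exact natCast_not_mem_of_finBelow (F := F) u h1

/-- **`h412` of p456387's `componentSums_of_genuine_defn` DISCHARGED for Joshi's data `𝔮_F = ofNFPointOver λ S F` (`ℓ ∈ S`;
his `S = {2, ℓ}`)** on the `ℓ`-division tower modulo (P2): every `w ∈ Supp(𝔮_F)` has above it a place `u` of `K` (any prime of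
`𝓞_K` over `w`) with the same residue characteristic and `2 ≤ e(u|p_u)` — VERBATIM the binder
`∀ w ∈ 𝔮.V, ∃ u, residueChar K u = residueChar L w ∧ 2 ≤ u.asIdeal.ramificationIdx ℤ` at `L = F`. PROVED.
[claim: Joshi2024ATS4, status: disputed] -/
theorem h412_ofNFPointOver (hU : P.InU) (hF : IsThetaField P F) {ℓ : ℕ} (hℓ : ℓ.Prime) (h7 : 7 ≤ ℓ) (hP2 : CondP2 P ℓ)
    (hKℓ : ∀ (σ : Field.absoluteGaloisGroup K) (Q : WeierstrassCurve.geomTorsion (thetaCurve P K) (ℓ : ℤ)), σ • Q = Q)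
    {S : Finset ℕ} (hS : ℓ ∈ S) :
    ∀ w ∈ (TateDivisorDatum.ofNFPointOver P S F).V,
      ∃ u : HeightOneSpectrum (𝓞 K), residueChar K u = residueChar F w ∧ 2 ≤ u.asIdeal.ramificationIdx ℤ := by
  intro w hw
  obtain ⟨hbad, hSav⟩ := finBelow_mem_badPlaces_of_mem_ofNFPointOver hw
  haveI := w.isPrime
  obtain ⟨⟨U, hUp, hUo⟩⟩ := w.asIdeal.nonempty_primesOver (S := 𝓞 K)
  haveI := hUp
  haveI := hUo
  let u : HeightOneSpectrum (𝓞 K) := ⟨U, hUp, Ideal.ne_bot_of_liesOver_of_ne_bot w.ne_bot U⟩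
  have hfb : finBelow F K u = w := HeightOneSpectrum.ext hUo.over.symm
  refine ⟨u, ?_, ?_⟩
  · rw [← residueChar_finBelow (F := F) u, hfb]
  · refine two_le_absRamificationIdx_of_finBelow_mem_badPlaces hU hF hℓ h7 hP2 hKℓ u ?_ ?_
    · rwa [← finBelow_finBelow (F := F), hfb]
    · refine natCast_not_mem_of_finBelow (F := F) u ?_
      rw [hfb]
      exact natCast_not_mem_of_finBelow (F := P.F) w (hSav ℓ hS)

/-- **The `q_L`-clause of (4) ⟹ (1) in `Finset` form**: `p(Supp 𝔮_F) ⊆ primeFactors(disc K)` for Joshi's data over the theta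
field (`ℓ ∈ S`), on the `ℓ`-division tower modulo (P2). PROVED. [claim: Joshi2024ATS4, status: disputed] -/
theorem image_residueChar_ofNFPointOver_subset_primeFactors_discr (hU : P.InU) (hF : IsThetaField P F) {ℓ : ℕ}
    (hℓ : ℓ.Prime) (h7 : 7 ≤ ℓ) (hP2 : CondP2 P ℓ)
    (hKℓ : ∀ (σ : Field.absoluteGaloisGroup K) (Q : WeierstrassCurve.geomTorsion (thetaCurve P K) (ℓ : ℤ)), σ • Q = Q)
    {S : Finset ℕ} (hS : ℓ ∈ S) :
    (TateDivisorDatum.ofNFPointOver P S F).V.image (residueChar F) ⊆ (discr K).natAbs.primeFactors := by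
  intro p hp
  obtain ⟨w, hw, rfl⟩ := Finset.mem_image.mp hp
  obtain ⟨u, hu, hram⟩ := h412_ofNFPointOver hU hF hℓ h7 hP2 hKℓ hS w hw
  rw [← hu]
  exact residueChar_mem_primeFactors_discr u hram

/-- **The `q_{L_tpd}`-clause of (3) ⟹ (1) in `Finset` form**: `p(Supp 𝔮_{F_tpd}) ⊆ primeFactors(disc K)` for Joshi's data
`𝔮_{F_tpd} = ofNFPoint λ S` on the `λ`-line itself (`ℓ ∈ S`): every bad place `v ∤ S` of `λ` has SOME place of `K` above it, and
that place is ramified over `ℚ`. PROVED modulo (P2). [claim: Joshi2024ATS4, status: disputed] -/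
theorem image_residueChar_ofNFPoint_subset_primeFactors_discr (hU : P.InU) (hF : IsThetaField P F) {ℓ : ℕ}
    (hℓ : ℓ.Prime) (h7 : 7 ≤ ℓ) (hP2 : CondP2 P ℓ)
    (hKℓ : ∀ (σ : Field.absoluteGaloisGroup K) (Q : WeierstrassCurve.geomTorsion (thetaCurve P K) (ℓ : ℤ)), σ • Q = Q)
    {S : Finset ℕ} (hS : ℓ ∈ S) :
    (TateDivisorDatum.ofNFPoint P S).V.image (residueChar P.F) ⊆ (discr K).natAbs.primeFactors := by
  intro p hp
  obtain ⟨v, hv, rfl⟩ := Finset.mem_image.mp hp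
  obtain ⟨hbad, hSav⟩ := (TateDivisorDatum.mem_ofNFPoint_V P S v).1 hv
  haveI := v.isPrime
  obtain ⟨⟨U, hUp, hUo⟩⟩ := v.asIdeal.nonempty_primesOver (S := 𝓞 K)
  haveI := hUp
  haveI := hUo
  let u : HeightOneSpectrum (𝓞 K) := ⟨U, hUp, Ideal.ne_bot_of_liesOver_of_ne_bot v.ne_bot U⟩
  have hfb : finBelow P.F K u = v := HeightOneSpectrum.ext hUo.over.symm
  rw [← hfb, residueChar_finBelow]
  refine residueChar_mem_primeFactors_discr_of_finBelow_mem_badPlaces hU hF hℓ h7 hP2 hKℓ u (hfb ▸ hbad) ?_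
  refine natCast_not_mem_of_finBelow (F := P.F) u ?_
  rw [hfb]
  exact hSav ℓ hS

end GenuineVdst

/-! ## 4. Rows Y-21e / Y-21c with `V^dst_ℚ` read by the §6.6 DEFINITION, on the `ℓ`-division tower, modulo (P2) -/

section DivisionTower

variable {P : NFPoint} {F : Type} [Field F] [NumberField F] [Algebra P.F F]
variable {K : Type} [Field K] [NumberField K] [Algebra F K] [Algebra P.F K] [IsScalarTower P.F F K]

/-- **Row Y-21e (`ComponentSums`) with `V^dst_ℚ := primeFactors(disc K)` (the §6.6 DEFINITION, Lemma 6.7.1 (1)/(2)) DERIVED on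
the genuine `ℓ`-division tower** `F_tpd ⊆ F ⊆ K ⊇ F(E_F[ℓ])`, `ℓ ≥ 7` prime, modulo the rider (P2): p456387's
`componentSums_of_genuine_defn` with its hypothesis `h412` supplied by `GenuineVdst.h412_ofNFPointOver` for Joshi's data
`𝔮_F = ofNFPointOver λ S F`, `ℓ ∈ S`; the `d_{L′}`-, `q`-slots read genuinely at `K`, `𝔮_F`, the `s`-slots by E-t31's `TowerGlue`.
PROVED. [claim: Joshi2024ATS4, status: disputed] -/
theorem LocusVolumeDatum.componentSums_divisionTower_defn (d : LocusVolumeDatum) {T : PrimeTowerDatum}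
    (GT : PrimeTowerDatum.TowerGlue T d) (hU : P.InU) (hF : IsThetaField P F) {ℓ : ℕ} (hℓ : ℓ.Prime) (h7 : 7 ≤ ℓ)
    (hP2 : CondP2 P ℓ)
    (hKℓ : ∀ (σ : Field.absoluteGaloisGroup K) (Q : WeierstrassCurve.geomTorsion (thetaCurve P K) (ℓ : ℤ)), σ • Q = Q)
    {S : Finset ℕ} (hS : ℓ ∈ S)
    (hVdst : d.Vdst = (discr K).natAbs.primeFactors)
    (DK : Finset (HeightOneSpectrum (𝓞 K))) (hDK : ∀ u, differentDivisor K (Sum.inr u) ≠ 0 → u ∈ DK)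
    (hDiff : d.logDiffLp = logDifferent K)
    (hDiffAt : ∀ p ∈ d.Vdst, d.logDiffLpAt p =
      (Module.finrank ℚ K : ℝ)⁻¹ * ∑ u ∈ DK with residueChar K u = p, differentDivisor K (Sum.inr u) * logNorm K u)
    (hq : d.logq = (TateDivisorDatum.ofNFPointOver P S F).logq)
    (hqAt : ∀ p ∈ d.Vdst, d.logqAt p =
      (Module.finrank ℚ F : ℝ)⁻¹ * ∑ w ∈ (TateDivisorDatum.ofNFPointOver P S F).V with residueChar F w = p,
        (TateDivisorDatum.ofNFPointOver P S F).tateDivisor (Sum.inr w) * logNorm F w) :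
    d.ComponentSums :=
  d.componentSums_of_genuine_defn GT (TateDivisorDatum.ofNFPointOver P S F) hVdst
    (GenuineVdst.h412_ofNFPointOver hU hF hℓ h7 hP2 hKℓ hS) DK hDK hDiff hDiffAt hq hqAt

/-- **Row Y-21c (`Eq6111`) with `V^dst_ℚ := primeFactors(disc K)` DERIVED on the `ℓ`-division tower** modulo (P2): E-t4's
places `w ∈ W` are places of `Supp(𝔮_F)` (`ι`), each of whose residue characteristics lies in `primeFactors(disc K)` by
`GenuineVdst.h412_ofNFPointOver` + Dedekind; then p456387's `eq6111_of_genuine` applies. PROVED. [claim: Joshi2024ATS4, status: disputed] -/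
theorem LocusVolumeDatum.eq6111_divisionTower_defn (d : LocusVolumeDatum) {lstar : ℕ} {W : Type} [Fintype W]
    {D : SecondMainBoundDatum lstar W} (G : DescentGlue D d) (hU : P.InU) (hF : IsThetaField P F) {ℓ : ℕ} (hℓ : ℓ.Prime)
    (h7 : 7 ≤ ℓ) (hP2 : CondP2 P ℓ)
    (hKℓ : ∀ (σ : Field.absoluteGaloisGroup K) (Q : WeierstrassCurve.geomTorsion (thetaCurve P K) (ℓ : ℤ)), σ • Q = Q)
    {S : Finset ℕ} (hS : ℓ ∈ S) (hVdst : d.Vdst = (discr K).natAbs.primeFactors)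
    (ι : W → HeightOneSpectrum (𝓞 F)) (hι : ∀ w, ι w ∈ (TateDivisorDatum.ofNFPointOver P S F).V)
    (hAt : ∀ p ∈ d.Vdst, d.logVolAt p =
      ∑ w ∈ Finset.univ with residueChar F (ι w) = p, |Real.log (D.std.loc w).hullVol|)
    (hArch : d.logVolArch = 0) : d.Eq6111 :=
  d.eq6111_of_genuine G (fun w => residueChar F (ι w)) (fun w => by
      obtain ⟨u, hu, hram⟩ := GenuineVdst.h412_ofNFPointOver hU hF hℓ h7 hP2 hKℓ hS (ι w) (hι w)
      rw [hVdst, ← hu]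
      exact GenuineVdst.residueChar_mem_primeFactors_discr u hram)
    hAt hArch

end DivisionTower

/-! ## 5. (v2) Lemma 6.7.1 (1) ⟺ (3) AWAY FROM `30ℓ` on the `ℓ`-division tower `K = F(E_F[ℓ])`, modulo (P2) -/

section Comparison

variable {P : NFPoint} {F : Type} [Field F] [NumberField F] [Algebra P.F F]
variable {K : Type} [Field K] [NumberField K] [Algebra F K] (ψ : K →ₐ[F] AlgebraicClosure F)
variable [Algebra P.F K] [IsScalarTower P.F F K]

/-- `primeFactors(disc M) ⊆ primeFactors(disc K)` for number fields `M ⊆ K` (`disc M ∣ disc K`, Mathlib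
`NumberField.discr_dvd_discr`): the `d_L` / `d_{L_tpd}` clauses of Lemma 6.7.1 (3)/(4) ⟹ (1) («a prime ramified in a subfield
is ramified in `L′`»). [cite: NeukirchANT1999, Ch. III (2.10)] -/
theorem GenuineVdst.primeFactors_discr_mono (M K : Type*) [Field M] [NumberField M] [Field K] [NumberField K] [Algebra M K] :
    (discr M).natAbs.primeFactors ⊆ (discr K).natAbs.primeFactors :=
  Nat.primeFactors_mono (Int.natAbs_dvd_natAbs.mpr (NumberField.discr_dvd_discr M K))
    (Int.natAbs_ne_zero.mpr (discr_ne_zero K))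

/-- **Lemma 6.7.1 (3) ⟹ (1) off `30ℓ`, in `Finset` form**: `p(Supp 𝔮_{F_tpd}) ∪ primeFactors(disc F_tpd) ⊆ primeFactors(disc K)`
for Joshi's data `𝔮_{F_tpd} = ofNFPoint λ S` (`ℓ ∈ S`) on the `ℓ`-division tower `K ⊇ F(E_F[ℓ])`, `ℓ ≥ 7`, modulo (P2).
(The remaining clause «`30ℓ` ramifies in `L′ ⊇ ℚ(ζ_{60ℓ})`» needs the Weil pairing and is not treated.) PROVED.
[claim: Joshi2024ATS4, status: disputed] -/
theorem GenuineVdst.reading3_subset_primeFactors_discr (hU : P.InU) (hF : IsThetaField P F) {ℓ : ℕ} (hℓ : ℓ.Prime)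
    (h7 : 7 ≤ ℓ) (hP2 : CondP2 P ℓ)
    (hKℓ : ∀ (σ : Field.absoluteGaloisGroup K) (Q : WeierstrassCurve.geomTorsion (thetaCurve P K) (ℓ : ℤ)), σ • Q = Q)
    {S : Finset ℕ} (hS : ℓ ∈ S) :
    (TateDivisorDatum.ofNFPoint P S).V.image (residueChar P.F) ∪ (discr P.F).natAbs.primeFactors ⊆
      (discr K).natAbs.primeFactors :=
  Finset.union_subset (GenuineVdst.image_residueChar_ofNFPoint_subset_primeFactors_discr hU hF hℓ h7 hP2 hKℓ hS)
    (GenuineVdst.primeFactors_discr_mono P.F K)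

/-- **Lemma 6.7.1 (1) ⟺ (3) AWAY FROM the primes of `30ℓ`, on the genuine `ℓ`-division tower `F_tpd ⊆ F ⊆ K` with
`K ⊆ F(E_F[ℓ])` (`hK`, via `ψ`) AND `K ⊇ F(E_F[ℓ])` (`hKℓ`) — i.e. `K = F(E_F[ℓ])`, Joshi's `L′` —, `ℓ ≥ 7` prime, MODULO (P2)**,
for Joshi's data `𝔮_{F_tpd} = ofNFPoint λ S` with `S ⊆ {2,3,5,ℓ}` primes, `ℓ ∈ S` (his `S = {2, ℓ}`): the §6.6 DEFINITION of
`V^dst_ℚ` (`primeFactors(disc K)`, reading (1)/(2)) and the READING (3) (`p(Supp 𝔮_{F_tpd}) ∪ primeFactors(disc F_tpd)`) have the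
same primes off `30ℓ` — (1) ⊆ (3) ∪ primeFactors(30ℓ) is p456387's `primeFactors_discr_subset` (binder-free), (3) ⊆ (1) is
`reading3_subset_primeFactors_discr` (modulo the rider). PROVED. [claim: Joshi2024ATS4, status: disputed] -/
theorem GenuineVdst.primeFactors_discr_sdiff_eq_reading3_sdiff (hU : P.InU) (hF : IsThetaField P F) [IsGalois F K] {ℓ : ℕ}
    (hℓ : ℓ.Prime) (h7 : 7 ≤ ℓ) (hP2 : CondP2 P ℓ)
    (hK : letI := thetaCurve_isElliptic hU F
      ((thetaCurve P F).galoisRepTorsion (ℓ : ℤ)).ker ≤ ψ.fieldRange.fixingSubgroup)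
    (hKℓ : ∀ (σ : Field.absoluteGaloisGroup K) (Q : WeierstrassCurve.geomTorsion (thetaCurve P K) (ℓ : ℤ)), σ • Q = Q)
    {S : Finset ℕ} (hS : S ⊆ ({2, 3, 5, ℓ} : Finset ℕ)) (hSp : ∀ p ∈ S, p.Prime) (hℓS : ℓ ∈ S) :
    (discr K).natAbs.primeFactors \ (2 * 3 * 5 * ℓ).primeFactors =
      ((TateDivisorDatum.ofNFPoint P S).V.image (residueChar P.F) ∪ (discr P.F).natAbs.primeFactors) \
        (2 * 3 * 5 * ℓ).primeFactors := by
  have h13 := GenuineVdst.primeFactors_discr_subset ψ hU hF hℓ hK (GenuineVdst.hsupp_ofNFPoint hS hSp)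
  have h31 := GenuineVdst.reading3_subset_primeFactors_discr (K := K) hU hF hℓ h7 hP2 hKℓ hℓS
  ext p
  simp only [Finset.mem_sdiff, Finset.mem_union]
  constructor
  · rintro ⟨hp, hp30⟩
    have h := h13 hp
    simp only [Finset.mem_union] at h
    rcases h with (h | h) | h
    · exact absurd h hp30
    · exact ⟨Or.inl h, hp30⟩
    · exact ⟨Or.inr h, hp30⟩
  · rintro ⟨hp, hp30⟩
    exact ⟨h31 (Finset.mem_union.mpr hp), hp30⟩

end Comparison

end Summit.ABC.IUTFork.Joshi.ATS4

end
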